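import Literature.NumberTheory.IwasawaTheory.ClassicalMuVanishesUnitNormIndexAnyPrime
import Literature.NumberTheory.NumberFields.QuadraticExtensionOddClassNumberTwoNonNormUnits
import HarnessLib

/-!
# The unit-norm-index doors in a `ℤ₂`-tower from EXPLICIT NON-NORM UNITS: one unit (at most two ramified primes) or
# two independent units (at most three ramified primes) of the layer `K_n`, not norms from `K_{n+1}`

Topic `NumberTheory/IwasawaTheory` (namespace = path).  THEOREMS ONLY (no definition, no named fact, no instance, no
`sorry`).  The `p = 2` consumer forms of `ClassicalMuVanishesUnitNormIndexAnyPrime.lean`: there the doors ask for the LOWER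
bound `2^s ∣ [E_{K_n} : E_{K_n} ∩ N K_{n+1}ˣ] · 2` with at most `s` ramified primes; for `s = 2` this is ONE unit of `K_n` that is
not a norm from `K_{n+1}ˣ` (tree `AmbiguousClass.two_dvd_relIndex_unitsNorm_of_not_mem`), for `s = 3` TWO units `x, y` with
`x`, `y`, `xy` all outside `N K_{n+1}ˣ` (tree `AmbiguousClass.four_dvd_relIndex_unitsNorm_of_not_mem`).  Non-norm units are what
the tree certifies in the kernel at dyadic primes (`DyadicUnitNotNormFromSqrtTwo.lean`: `ε ≡ ±3 (mod 𝔭³)` at a prime with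
`e = f = 1` is not `a² − 2b²`; `DyadicUnitSquaresRamifiedPrime.lean`: `ε ≡ 5 (mod 4𝔭)` at a prime with `e = 2`, `f = 1` is not
`a² − πμ b²`), so the doors below have kernel-decidable unit inputs; the class-group inputs (`2 ∤ h_K`, or the generation of
`Cl(K_n)` modulo squares by the ramified primes) stay displayed data.

* door U (`2 ∤ h_K`, first layer `K₁ = κ.layer 1`, Fukuda's index `0`), unconditional:
  `classNumberPExp_eq_zero_two_of_nonNorm_unit` (at most two primes above `2`, one non-norm unit ⟹ `e_n = 0` for all `n`),
  `classNumberPExp_eq_zero_two_of_two_nonNorm_units` (at most three primes above `2`, two independent non-norm units),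
  and the growth forms `classicalMuVanishes_two_of_nonNorm_unit`, `classicalMuVanishes_two_of_two_nonNorm_units`;
* door UG (any `h`, layer `K_{n+1}/K_n`, ramified classes generating `Cl(K_n)` modulo squares), unconditional:
  `classNumberPExp_succ_eq_two_of_nonNorm_unit_of_sup_eq_top` / `…_of_two_nonNorm_units_of_sup_eq_top` (`e_{n+1} = e_n`),
  and, with Fukuda's index `n₀ ≤ n`, `classNumberPExp_eq_of_le_two_of_two_nonNorm_units_of_sup_eq_top` (`e_m = e_n` for
  `m ≥ n`), `classicalMuVanishes_two_of_two_nonNorm_units_of_sup_eq_top` (`μ = 0`),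
  `classicalLambda_eq_zero_two_of_two_nonNorm_units_of_sup_eq_top` (`λ = 0`).

The two-unit door UG at the layer `K_2/K_1` is the shape needed for the cyclotomic `ℤ₂`-tower of a cubic field in which `2`
splits into three primes (three ramified primes at every layer; `e_1 ≥ e_0 + 1`, so no layer-`(0,1)` door): its inputs are
`ord₂ h(K_1)`, the generation of `Cl(K_1)/2` by the three dyadic primes of the sextic `K_1 = K(√2)`, and two units of `K_1`
with the three non-norm conditions — no datum of the degree-`12` field `K_2`.  All statements are unconditional (Fukuda's
Thm. 1 (1) is the tree theorem `fukuda1994_thm1_classNumberPExp_const_of_succ_eq_holds`; the archimedean factor is `1` along any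
`ℤ₂`-tower).  The finite-dimensionality instances `[FiniteDimensional K (κ.layer 1)]`, resp. `[FiniteDimensional K (κ.layer (n+1))]`
and `[FiniteDimensional (κ.layer n) (κ.layer (n+1))]`, needed to STATE the norm subgroup (a finite Galois group), are instance
arguments; a consumer supplies them by `κ.finiteDimensional_layer_holds _` / `Module.Finite.of_restrictScalars_finite K _ _`.
HONEST SCOPE: classical genus theory + Fukuda; nothing specific to any summit; BSD is not advanced by this file.

## References

* S. Lang, *Cyclotomic Fields I and II*, GTM 121 (1990), Ch. 13 §4, Lemma 4.1–4.2 (PDF pp. 203–204). [Lang1990]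
* G. Gras, *Class Field Theory* (2003), II.6.2.3, IV.4 (genus theory). [Gras2003]
* T. Fukuda, *Remarks on `ℤ_p`-extensions of number fields*, Proc. Japan Acad. 70 A (1994), Thm. 1 (1), p. 264. [Fukuda1994]
* L. C. Washington, *Introduction to Cyclotomic Fields*, 2nd ed., GTM 83 (1997), §13.1 Prop. 13.2. [Washington1997]
-/

noncomputable section

open NumberField IsDedekindDomain
open scoped nonZeroDivisors

namespace Literature.NumberTheory.IwasawaTheory

open Literature.NumberTheory.EllipticCurves Literature.NumberTheory.NumberFields
  Literature.NumberTheory.NumberFields.AmbiguousClass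
  Literature.NumberTheory.GaloisRepresentations Literature.NumberTheory.GaloisRepresentations.Herbrand
  Literature.NumberTheory.GaloisRepresentations.MinkowskiUnit
  Literature.NumberTheory.GaloisRepresentations.CyclicNormIndex

variable {K : Type} [Field K] [NumberField K]

/-! ## §1 Door U at `p = 2`: `2 ∤ h_K`, non-norm units of `K` from the first layer -/

/-- **`e_1 = 0` at `2` with ONE non-norm unit.**  `K` a number field with `2 ∤ h_K` and at most two primes above `2`, `κ` a
`ℤ₂`-extension of `K`, and a unit `x` of `K` (inside `K₁ = κ.layer 1`) that is NOT a norm from `K₁ˣ`: then `ord₂ h(K₁) = 0`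
(`2 ∣ [E_K : E_K ∩ N K₁ˣ]` by `two_dvd_relIndex_unitsNorm_of_not_mem`, so `2² ∣ [E_K : …] · 2`; `K₁/K` is unramified at infinity
and ramified at most at the primes above `2`; `not_dvd_classNumber_of_pow_dvd_relIndex_mul`).  The Summits-side special case is
`AddKatoTwo.classNumberPExp_one_eq_zero_of_nonNorm_unit_two`. [cite: Lang1990, Ch. 13 §4, Lemma 4.1–4.2 (PDF pp. 203–204)]
[cite: Washington1997, §13.1 Prop. 13.2] -/
theorem classNumberPExp_one_eq_zero_two_of_nonNorm_unit (κ : ZpExtension K 2) [FiniteDimensional K (κ.layer 1)]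
    (hK : ¬ 2 ∣ classNumber K)
    (hs : {v : HeightOneSpectrum (𝓞 K) | ((2 : ℕ) : 𝓞 K) ∈ v.asIdeal}.ncard ≤ 2) {x : (κ.layer 1)ˣ}
    (hxE : x ∈ unitsE (κ.layer 1) ⊓ (unitsIncl K (κ.layer 1)).range)
    (hxN : x ∉ (⊤ : Subgroup (κ.layer 1)ˣ).map (Herbrand.norm (κ.layer 1 ≃ₐ[K] κ.layer 1))) :
    classNumberPExp κ 1 = 0 := by
  haveI : IsGalois K (κ.layer 1) := κ.isGalois_layer_holds 1
  haveI : NumberField (κ.layer 1) := NumberField.of_module_finite K (κ.layer 1)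
  haveI : IsUnramifiedAtInfinitePlaces K (κ.layer 1) := κ.isUnramifiedAtInfinitePlaces_layer 1
  have hdeg : Module.finrank K (κ.layer 1) = 2 := by rw [κ.finrank_layer_holds 1, pow_one]
  obtain ⟨k, hk⟩ := two_dvd_relIndex_unitsNorm_of_not_mem hdeg hxE hxN
  rw [classNumberPExp_eq_padicValNat_classNumber]
  refine padicValNat.eq_zero_of_not_dvd ?_
  refine not_dvd_classNumber_of_pow_dvd_relIndex_mul Nat.prime_two hdeg hK
    ((ncard_ramified_layer_le_of_ncard_eq κ 1 rfl).trans hs) ⟨k, ?_⟩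
  rw [hk]; ring

/-- **Door U at `2` with ONE non-norm unit: `e_n = 0` for all `n`** (unconditional).  `K` a number field with `2 ∤ h_K` and
at most two primes above `2`, `κ` a `ℤ₂`-extension of `K` with Fukuda's index `0` (`TotallyRamifiedFrom κ 0`), and a unit of
`K` that is not a norm from `K₁ˣ`: then `ord₂ h(K_n) = 0` for every `n` (`e_0 = e_1 = 0`, then Fukuda's Thm. 1 (1), a tree
theorem). [cite: Lang1990, Ch. 13 §4, Lemma 4.1–4.2 (PDF pp. 203–204)] [cite: Fukuda1994, Thm. 1 (1), p. 264] -/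
theorem classNumberPExp_eq_zero_two_of_nonNorm_unit (κ : ZpExtension K 2) [FiniteDimensional K (κ.layer 1)]
    (hram : TotallyRamifiedFrom κ 0)
    (hK : ¬ 2 ∣ classNumber K) (hs : {v : HeightOneSpectrum (𝓞 K) | ((2 : ℕ) : 𝓞 K) ∈ v.asIdeal}.ncard ≤ 2)
    {x : (κ.layer 1)ˣ} (hxE : x ∈ unitsE (κ.layer 1) ⊓ (unitsIncl K (κ.layer 1)).range)
    (hxN : x ∉ (⊤ : Subgroup (κ.layer 1)ˣ).map (Herbrand.norm (κ.layer 1 ≃ₐ[K] κ.layer 1))) (n : ℕ) :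
    classNumberPExp κ n = 0 := by
  have h0 : classNumberPExp κ 0 = 0 := by
    rw [classNumberPExp_zero_eq_padicValNat_classNumber]
    exact padicValNat.eq_zero_of_not_dvd hK
  exact classNumberPExp_eq_zero_of_succ_eq_zero fukuda1994_thm1_classNumberPExp_const_of_succ_eq_holds κ hram le_rfl h0
    (classNumberPExp_one_eq_zero_two_of_nonNorm_unit κ hK hs hxE hxN) (Nat.zero_le n)

/-- Corollary (growth form): under the hypotheses of `classNumberPExp_eq_zero_two_of_nonNorm_unit`, `μ₂ = 0` (indeed
`λ = ν = 0`), i.e. `ClassicalMuVanishes κ`. [cite: Fukuda1994, Thm. 1 (1), p. 264] -/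
theorem classicalMuVanishes_two_of_nonNorm_unit (κ : ZpExtension K 2) [FiniteDimensional K (κ.layer 1)]
    (hram : TotallyRamifiedFrom κ 0)
    (hK : ¬ 2 ∣ classNumber K) (hs : {v : HeightOneSpectrum (𝓞 K) | ((2 : ℕ) : 𝓞 K) ∈ v.asIdeal}.ncard ≤ 2)
    {x : (κ.layer 1)ˣ} (hxE : x ∈ unitsE (κ.layer 1) ⊓ (unitsIncl K (κ.layer 1)).range)
    (hxN : x ∉ (⊤ : Subgroup (κ.layer 1)ˣ).map (Herbrand.norm (κ.layer 1 ≃ₐ[K] κ.layer 1))) :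
    ClassicalMuVanishes κ :=
  classicalMuVanishes_of_eventually_const κ (c := 0) (n₀ := 0)
    fun n _ => classNumberPExp_eq_zero_two_of_nonNorm_unit κ hram hK hs hxE hxN n

/-- **`e_1 = 0` at `2` with TWO independent non-norm units.**  `K` a number field with `2 ∤ h_K` and at most THREE primes
above `2`, `κ` a `ℤ₂`-extension of `K`, and units `x, y` of `K` (inside `K₁`) with `x`, `y`, `xy` all outside `N K₁ˣ`: then
`ord₂ h(K₁) = 0` (`4 ∣ [E_K : E_K ∩ N K₁ˣ]` by `four_dvd_relIndex_unitsNorm_of_not_mem`, so `2³ ∣ [E_K : …] · 2`).  No total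
reality of `K₁` is needed (compare `odd_classNumber_of_quadratic_of_isTotallyReal_of_not_mem_norm₂`): a layer of a
`ℤ₂`-extension is unramified at infinity. [cite: Lang1990, Ch. 13 §4, Lemma 4.1–4.2 (PDF pp. 203–204)]
[cite: Washington1997, §13.1 Prop. 13.2] -/
theorem classNumberPExp_one_eq_zero_two_of_two_nonNorm_units (κ : ZpExtension K 2)
    [FiniteDimensional K (κ.layer 1)] (hK : ¬ 2 ∣ classNumber K)
    (hs : {v : HeightOneSpectrum (𝓞 K) | ((2 : ℕ) : 𝓞 K) ∈ v.asIdeal}.ncard ≤ 3) {x y : (κ.layer 1)ˣ}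
    (hxE : x ∈ unitsE (κ.layer 1) ⊓ (unitsIncl K (κ.layer 1)).range)
    (hyE : y ∈ unitsE (κ.layer 1) ⊓ (unitsIncl K (κ.layer 1)).range)
    (hxN : x ∉ (⊤ : Subgroup (κ.layer 1)ˣ).map (Herbrand.norm (κ.layer 1 ≃ₐ[K] κ.layer 1)))
    (hyN : y ∉ (⊤ : Subgroup (κ.layer 1)ˣ).map (Herbrand.norm (κ.layer 1 ≃ₐ[K] κ.layer 1)))
    (hxyN : x * y ∉ (⊤ : Subgroup (κ.layer 1)ˣ).map (Herbrand.norm (κ.layer 1 ≃ₐ[K] κ.layer 1))) :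
    classNumberPExp κ 1 = 0 := by
  haveI : IsGalois K (κ.layer 1) := κ.isGalois_layer_holds 1
  haveI : NumberField (κ.layer 1) := NumberField.of_module_finite K (κ.layer 1)
  haveI : IsUnramifiedAtInfinitePlaces K (κ.layer 1) := κ.isUnramifiedAtInfinitePlaces_layer 1
  have hdeg : Module.finrank K (κ.layer 1) = 2 := by rw [κ.finrank_layer_holds 1, pow_one]
  obtain ⟨k, hk⟩ := four_dvd_relIndex_unitsNorm_of_not_mem hdeg hxE hyE hxN hyN hxyN
  rw [classNumberPExp_eq_padicValNat_classNumber]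
  refine padicValNat.eq_zero_of_not_dvd ?_
  refine not_dvd_classNumber_of_pow_dvd_relIndex_mul Nat.prime_two hdeg hK
    ((ncard_ramified_layer_le_of_ncard_eq κ 1 rfl).trans hs) ⟨k, ?_⟩
  rw [hk]; ring

/-- **Door U at `2` with TWO independent non-norm units: `e_n = 0` for all `n`** (unconditional).  `2 ∤ h_K`, at most
three primes above `2`, Fukuda's index `0`, units `x, y` of `K` with `x`, `y`, `xy ∉ N K₁ˣ` ⟹ `ord₂ h(K_n) = 0` for all `n`.
(E.g. a totally real cubic field of odd class number in which `2` splits completely, with two fundamental units whose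
`2`-adic residues at suitable split primes are `≡ ±3 (mod 8)`.) [cite: Lang1990, Ch. 13 §4, Lemma 4.1–4.2 (PDF pp. 203–204)]
[cite: Fukuda1994, Thm. 1 (1), p. 264] -/
theorem classNumberPExp_eq_zero_two_of_two_nonNorm_units (κ : ZpExtension K 2)
    [FiniteDimensional K (κ.layer 1)] (hram : TotallyRamifiedFrom κ 0)
    (hK : ¬ 2 ∣ classNumber K) (hs : {v : HeightOneSpectrum (𝓞 K) | ((2 : ℕ) : 𝓞 K) ∈ v.asIdeal}.ncard ≤ 3)
    {x y : (κ.layer 1)ˣ} (hxE : x ∈ unitsE (κ.layer 1) ⊓ (unitsIncl K (κ.layer 1)).range)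
    (hyE : y ∈ unitsE (κ.layer 1) ⊓ (unitsIncl K (κ.layer 1)).range)
    (hxN : x ∉ (⊤ : Subgroup (κ.layer 1)ˣ).map (Herbrand.norm (κ.layer 1 ≃ₐ[K] κ.layer 1)))
    (hyN : y ∉ (⊤ : Subgroup (κ.layer 1)ˣ).map (Herbrand.norm (κ.layer 1 ≃ₐ[K] κ.layer 1)))
    (hxyN : x * y ∉ (⊤ : Subgroup (κ.layer 1)ˣ).map (Herbrand.norm (κ.layer 1 ≃ₐ[K] κ.layer 1))) (n : ℕ) :
    classNumberPExp κ n = 0 := by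
  have h0 : classNumberPExp κ 0 = 0 := by
    rw [classNumberPExp_zero_eq_padicValNat_classNumber]
    exact padicValNat.eq_zero_of_not_dvd hK
  exact classNumberPExp_eq_zero_of_succ_eq_zero fukuda1994_thm1_classNumberPExp_const_of_succ_eq_holds κ hram le_rfl h0
    (classNumberPExp_one_eq_zero_two_of_two_nonNorm_units κ hK hs hxE hyE hxN hyN hxyN) (Nat.zero_le n)

/-- Corollary (growth form): under the hypotheses of `classNumberPExp_eq_zero_two_of_two_nonNorm_units`, `μ₂ = 0` (indeed
`λ = ν = 0`), i.e. `ClassicalMuVanishes κ`. [cite: Fukuda1994, Thm. 1 (1), p. 264] -/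
theorem classicalMuVanishes_two_of_two_nonNorm_units (κ : ZpExtension K 2)
    [FiniteDimensional K (κ.layer 1)] (hram : TotallyRamifiedFrom κ 0)
    (hK : ¬ 2 ∣ classNumber K) (hs : {v : HeightOneSpectrum (𝓞 K) | ((2 : ℕ) : 𝓞 K) ∈ v.asIdeal}.ncard ≤ 3)
    {x y : (κ.layer 1)ˣ} (hxE : x ∈ unitsE (κ.layer 1) ⊓ (unitsIncl K (κ.layer 1)).range)
    (hyE : y ∈ unitsE (κ.layer 1) ⊓ (unitsIncl K (κ.layer 1)).range)
    (hxN : x ∉ (⊤ : Subgroup (κ.layer 1)ˣ).map (Herbrand.norm (κ.layer 1 ≃ₐ[K] κ.layer 1)))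
    (hyN : y ∉ (⊤ : Subgroup (κ.layer 1)ˣ).map (Herbrand.norm (κ.layer 1 ≃ₐ[K] κ.layer 1)))
    (hxyN : x * y ∉ (⊤ : Subgroup (κ.layer 1)ˣ).map (Herbrand.norm (κ.layer 1 ≃ₐ[K] κ.layer 1))) :
    ClassicalMuVanishes κ :=
  classicalMuVanishes_of_eventually_const κ (c := 0) (n₀ := 0)
    fun n _ => classNumberPExp_eq_zero_two_of_two_nonNorm_units κ hram hK hs hxE hyE hxN hyN hxyN n

/-! ## §2 Door UG at `p = 2`: a layer `K_{n+1}/K_n`, non-norm units of `K_n`, ramified classes generating `Cl(K_n)/2` -/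

section Layer

variable (κ : ZpExtension K 2) (n : ℕ) [NumberField (κ.layer n)] [Algebra (κ.layer n) (κ.layer (n + 1))]
  [IsScalarTower K (κ.layer n) (κ.layer (n + 1))]
  [FiniteDimensional K (κ.layer (n + 1))] [FiniteDimensional (κ.layer n) (κ.layer (n + 1))]

/-- **Door UG at `2` with ONE non-norm unit: `e_{n+1} = e_n`** (unconditional).  For a `ℤ₂`-extension `κ` of `K` and a layer
`K_{n+1}/K_n` (a `K_n`-algebra compatibly with `K`) with at most two ramified primes, a unit `x` of `K_n` that is not a norm from
`K_{n+1}ˣ`, and the classes of the ramified primes generating `Cl(K_n)` modulo squares: `ord₂ h(K_{n+1}) = ord₂ h(K_n)`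
(`2 ∣` the unit norm index, then `classNumberPExp_succ_eq_of_pow_dvd_of_sup_eq_top` with `s = 2`). [folklore]
[cite: Lang1990, Ch. 13 §4, Lemma 4.1–4.2 and sequel (PDF pp. 203–204)] -/
theorem classNumberPExp_succ_eq_two_of_nonNorm_unit_of_sup_eq_top
    (hs : {w : HeightOneSpectrum (𝓞 (κ.layer n)) |
        w.asIdeal.ramificationIdxIn (𝓞 (κ.layer (n + 1))) ≠ 1}.ncard ≤ 2) {x : (κ.layer (n + 1))ˣ}
    (hxE : x ∈ unitsE (κ.layer (n + 1)) ⊓ (unitsIncl (κ.layer n) (κ.layer (n + 1))).range)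
    (hxN : x ∉ (⊤ : Subgroup (κ.layer (n + 1))ˣ).map
        (Herbrand.norm (κ.layer (n + 1) ≃ₐ[κ.layer n] κ.layer (n + 1))))
    (hgen : Subgroup.closure {c : ClassGroup (𝓞 (κ.layer n)) |
        ∃ w : HeightOneSpectrum (𝓞 (κ.layer n)),
          w.asIdeal.ramificationIdxIn (𝓞 (κ.layer (n + 1))) ≠ 1 ∧
            c = ClassGroup.mk0 ⟨w.asIdeal, mem_nonZeroDivisors_of_ne_zero w.ne_bot⟩} ⊔
      (powMonoidHom 2 : ClassGroup (𝓞 (κ.layer n)) →* ClassGroup (𝓞 (κ.layer n))).range = ⊤) :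
    classNumberPExp κ (n + 1) = classNumberPExp κ n := by
  haveI : FiniteDimensional K (κ.layer n) := κ.finiteDimensional_layer_holds n
  haveI : IsGalois K (κ.layer (n + 1)) := κ.isGalois_layer_holds (n + 1)
  haveI : IsGalois (κ.layer n) (κ.layer (n + 1)) := IsGalois.tower_top_of_isGalois K _ _
  haveI : NumberField (κ.layer (n + 1)) := NumberField.of_module_finite K (κ.layer (n + 1))
  haveI : Module.Free (κ.layer n) (κ.layer (n + 1)) := Module.Free.of_divisionRing _ _
  have hdeg : Module.finrank (κ.layer n) (κ.layer (n + 1)) = 2 := by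
    have h := Module.finrank_mul_finrank K (κ.layer n) (κ.layer (n + 1))
    rw [κ.finrank_layer_holds n, κ.finrank_layer_holds (n + 1), pow_succ] at h
    exact Nat.eq_of_mul_eq_mul_left (pow_pos Nat.prime_two.pos n) h
  obtain ⟨k, hk⟩ := two_dvd_relIndex_unitsNorm_of_not_mem hdeg hxE hxN
  refine classNumberPExp_succ_eq_of_pow_dvd_of_sup_eq_top κ n hs ⟨k, ?_⟩ hgen
  rw [hk]; ring

/-- **Door UG at `2` with TWO independent non-norm units: `e_{n+1} = e_n`** (unconditional).  For a `ℤ₂`-extension `κ` of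
`K` and a layer `K_{n+1}/K_n` with at most THREE ramified primes, units `x, y` of `K_n` with `x`, `y`, `xy ∉ N K_{n+1}ˣ`, and
the classes of the ramified primes generating `Cl(K_n)` modulo squares: `ord₂ h(K_{n+1}) = ord₂ h(K_n)` (`4 ∣` the unit norm
index, then `classNumberPExp_succ_eq_of_pow_dvd_of_sup_eq_top` with `s = 3`).  At `n = 1` this is the door for the cyclotomic
`ℤ₂`-tower of a cubic field in which `2` splits completely. [folklore]
[cite: Lang1990, Ch. 13 §4, Lemma 4.1–4.2 and sequel (PDF pp. 203–204)] -/
theorem classNumberPExp_succ_eq_two_of_two_nonNorm_units_of_sup_eq_top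
    (hs : {w : HeightOneSpectrum (𝓞 (κ.layer n)) |
        w.asIdeal.ramificationIdxIn (𝓞 (κ.layer (n + 1))) ≠ 1}.ncard ≤ 3) {x y : (κ.layer (n + 1))ˣ}
    (hxE : x ∈ unitsE (κ.layer (n + 1)) ⊓ (unitsIncl (κ.layer n) (κ.layer (n + 1))).range)
    (hyE : y ∈ unitsE (κ.layer (n + 1)) ⊓ (unitsIncl (κ.layer n) (κ.layer (n + 1))).range)
    (hxN : x ∉ (⊤ : Subgroup (κ.layer (n + 1))ˣ).map
        (Herbrand.norm (κ.layer (n + 1) ≃ₐ[κ.layer n] κ.layer (n + 1))))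
    (hyN : y ∉ (⊤ : Subgroup (κ.layer (n + 1))ˣ).map
        (Herbrand.norm (κ.layer (n + 1) ≃ₐ[κ.layer n] κ.layer (n + 1))))
    (hxyN : x * y ∉ (⊤ : Subgroup (κ.layer (n + 1))ˣ).map
        (Herbrand.norm (κ.layer (n + 1) ≃ₐ[κ.layer n] κ.layer (n + 1))))
    (hgen : Subgroup.closure {c : ClassGroup (𝓞 (κ.layer n)) |
        ∃ w : HeightOneSpectrum (𝓞 (κ.layer n)),
          w.asIdeal.ramificationIdxIn (𝓞 (κ.layer (n + 1))) ≠ 1 ∧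
            c = ClassGroup.mk0 ⟨w.asIdeal, mem_nonZeroDivisors_of_ne_zero w.ne_bot⟩} ⊔
      (powMonoidHom 2 : ClassGroup (𝓞 (κ.layer n)) →* ClassGroup (𝓞 (κ.layer n))).range = ⊤) :
    classNumberPExp κ (n + 1) = classNumberPExp κ n := by
  haveI : FiniteDimensional K (κ.layer n) := κ.finiteDimensional_layer_holds n
  haveI : IsGalois K (κ.layer (n + 1)) := κ.isGalois_layer_holds (n + 1)
  haveI : IsGalois (κ.layer n) (κ.layer (n + 1)) := IsGalois.tower_top_of_isGalois K _ _
  haveI : NumberField (κ.layer (n + 1)) := NumberField.of_module_finite K (κ.layer (n + 1))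
  haveI : Module.Free (κ.layer n) (κ.layer (n + 1)) := Module.Free.of_divisionRing _ _
  have hdeg : Module.finrank (κ.layer n) (κ.layer (n + 1)) = 2 := by
    have h := Module.finrank_mul_finrank K (κ.layer n) (κ.layer (n + 1))
    rw [κ.finrank_layer_holds n, κ.finrank_layer_holds (n + 1), pow_succ] at h
    exact Nat.eq_of_mul_eq_mul_left (pow_pos Nat.prime_two.pos n) h
  obtain ⟨k, hk⟩ := four_dvd_relIndex_unitsNorm_of_not_mem hdeg hxE hyE hxN hyN hxyN
  refine classNumberPExp_succ_eq_of_pow_dvd_of_sup_eq_top κ n hs ⟨k, ?_⟩ hgen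
  rw [hk]; ring

/-- **Door UG at `2` with TWO independent non-norm units, along the tower: `e_m = e_n` for all `m ≥ n`** (unconditional).
Under the hypotheses of `classNumberPExp_succ_eq_two_of_two_nonNorm_units_of_sup_eq_top` and Fukuda's index `n₀ ≤ n`
(`TotallyRamifiedFrom κ n₀`), the `2`-class numbers are constant from `K_n` on (Fukuda's Thm. 1 (1), a tree theorem).
[folklore] [cite: Fukuda1994, Thm. 1 (1), p. 264] [cite: Lang1990, Ch. 13 §4, Lemma 4.1–4.2 and sequel (PDF pp. 203–204)] -/
theorem classNumberPExp_eq_of_le_two_of_two_nonNorm_units_of_sup_eq_top {n₀ : ℕ} (hram : TotallyRamifiedFrom κ n₀)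
    (hn : n₀ ≤ n)
    (hs : {w : HeightOneSpectrum (𝓞 (κ.layer n)) |
        w.asIdeal.ramificationIdxIn (𝓞 (κ.layer (n + 1))) ≠ 1}.ncard ≤ 3) {x y : (κ.layer (n + 1))ˣ}
    (hxE : x ∈ unitsE (κ.layer (n + 1)) ⊓ (unitsIncl (κ.layer n) (κ.layer (n + 1))).range)
    (hyE : y ∈ unitsE (κ.layer (n + 1)) ⊓ (unitsIncl (κ.layer n) (κ.layer (n + 1))).range)
    (hxN : x ∉ (⊤ : Subgroup (κ.layer (n + 1))ˣ).map
        (Herbrand.norm (κ.layer (n + 1) ≃ₐ[κ.layer n] κ.layer (n + 1))))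
    (hyN : y ∉ (⊤ : Subgroup (κ.layer (n + 1))ˣ).map
        (Herbrand.norm (κ.layer (n + 1) ≃ₐ[κ.layer n] κ.layer (n + 1))))
    (hxyN : x * y ∉ (⊤ : Subgroup (κ.layer (n + 1))ˣ).map
        (Herbrand.norm (κ.layer (n + 1) ≃ₐ[κ.layer n] κ.layer (n + 1))))
    (hgen : Subgroup.closure {c : ClassGroup (𝓞 (κ.layer n)) |
        ∃ w : HeightOneSpectrum (𝓞 (κ.layer n)),
          w.asIdeal.ramificationIdxIn (𝓞 (κ.layer (n + 1))) ≠ 1 ∧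
            c = ClassGroup.mk0 ⟨w.asIdeal, mem_nonZeroDivisors_of_ne_zero w.ne_bot⟩} ⊔
      (powMonoidHom 2 : ClassGroup (𝓞 (κ.layer n)) →* ClassGroup (𝓞 (κ.layer n))).range = ⊤)
    {m : ℕ} (hm : n ≤ m) : classNumberPExp κ m = classNumberPExp κ n :=
  fukuda1994_thm1_classNumberPExp_const_of_succ_eq_holds K 2 κ n₀ hram n hn
    (classNumberPExp_succ_eq_two_of_two_nonNorm_units_of_sup_eq_top κ n hs hxE hyE hxN hyN hxyN hgen) m hm

/-- **Door UG at `2` with TWO independent non-norm units: `μ₂ = 0`** in growth form (`λ = 0`, `ν = e_n`), unconditional,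
under the hypotheses of `classNumberPExp_eq_of_le_two_of_two_nonNorm_units_of_sup_eq_top`. [folklore]
[cite: Fukuda1994, Thm. 1 (1), p. 264] -/
theorem classicalMuVanishes_two_of_two_nonNorm_units_of_sup_eq_top {n₀ : ℕ} (hram : TotallyRamifiedFrom κ n₀)
    (hn : n₀ ≤ n)
    (hs : {w : HeightOneSpectrum (𝓞 (κ.layer n)) |
        w.asIdeal.ramificationIdxIn (𝓞 (κ.layer (n + 1))) ≠ 1}.ncard ≤ 3) {x y : (κ.layer (n + 1))ˣ}
    (hxE : x ∈ unitsE (κ.layer (n + 1)) ⊓ (unitsIncl (κ.layer n) (κ.layer (n + 1))).range)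
    (hyE : y ∈ unitsE (κ.layer (n + 1)) ⊓ (unitsIncl (κ.layer n) (κ.layer (n + 1))).range)
    (hxN : x ∉ (⊤ : Subgroup (κ.layer (n + 1))ˣ).map
        (Herbrand.norm (κ.layer (n + 1) ≃ₐ[κ.layer n] κ.layer (n + 1))))
    (hyN : y ∉ (⊤ : Subgroup (κ.layer (n + 1))ˣ).map
        (Herbrand.norm (κ.layer (n + 1) ≃ₐ[κ.layer n] κ.layer (n + 1))))
    (hxyN : x * y ∉ (⊤ : Subgroup (κ.layer (n + 1))ˣ).map
        (Herbrand.norm (κ.layer (n + 1) ≃ₐ[κ.layer n] κ.layer (n + 1))))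
    (hgen : Subgroup.closure {c : ClassGroup (𝓞 (κ.layer n)) |
        ∃ w : HeightOneSpectrum (𝓞 (κ.layer n)),
          w.asIdeal.ramificationIdxIn (𝓞 (κ.layer (n + 1))) ≠ 1 ∧
            c = ClassGroup.mk0 ⟨w.asIdeal, mem_nonZeroDivisors_of_ne_zero w.ne_bot⟩} ⊔
      (powMonoidHom 2 : ClassGroup (𝓞 (κ.layer n)) →* ClassGroup (𝓞 (κ.layer n))).range = ⊤) :
    ClassicalMuVanishes κ :=
  classicalMuVanishes_of_eventually_const κ (c := classNumberPExp κ n) (n₀ := n)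
    fun _ hm => classNumberPExp_eq_of_le_two_of_two_nonNorm_units_of_sup_eq_top κ n hram hn hs hxE hyE hxN hyN hxyN
      hgen hm

/-- Corollary: under the same hypotheses the classical `λ`-invariant vanishes, `classicalLambda κ = 0`.
[cite: Fukuda1994, Thm. 1 (1), p. 264 («μ_p(K/k) = λ_p(K/k) = 0»)] -/
theorem classicalLambda_eq_zero_two_of_two_nonNorm_units_of_sup_eq_top {n₀ : ℕ} (hram : TotallyRamifiedFrom κ n₀)
    (hn : n₀ ≤ n)
    (hs : {w : HeightOneSpectrum (𝓞 (κ.layer n)) |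
        w.asIdeal.ramificationIdxIn (𝓞 (κ.layer (n + 1))) ≠ 1}.ncard ≤ 3) {x y : (κ.layer (n + 1))ˣ}
    (hxE : x ∈ unitsE (κ.layer (n + 1)) ⊓ (unitsIncl (κ.layer n) (κ.layer (n + 1))).range)
    (hyE : y ∈ unitsE (κ.layer (n + 1)) ⊓ (unitsIncl (κ.layer n) (κ.layer (n + 1))).range)
    (hxN : x ∉ (⊤ : Subgroup (κ.layer (n + 1))ˣ).map
        (Herbrand.norm (κ.layer (n + 1) ≃ₐ[κ.layer n] κ.layer (n + 1))))
    (hyN : y ∉ (⊤ : Subgroup (κ.layer (n + 1))ˣ).map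
        (Herbrand.norm (κ.layer (n + 1) ≃ₐ[κ.layer n] κ.layer (n + 1))))
    (hxyN : x * y ∉ (⊤ : Subgroup (κ.layer (n + 1))ˣ).map
        (Herbrand.norm (κ.layer (n + 1) ≃ₐ[κ.layer n] κ.layer (n + 1))))
    (hgen : Subgroup.closure {c : ClassGroup (𝓞 (κ.layer n)) |
        ∃ w : HeightOneSpectrum (𝓞 (κ.layer n)),
          w.asIdeal.ramificationIdxIn (𝓞 (κ.layer (n + 1))) ≠ 1 ∧
            c = ClassGroup.mk0 ⟨w.asIdeal, mem_nonZeroDivisors_of_ne_zero w.ne_bot⟩} ⊔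
      (powMonoidHom 2 : ClassGroup (𝓞 (κ.layer n)) →* ClassGroup (𝓞 (κ.layer n))).range = ⊤) :
    classicalLambda κ = 0 :=
  classicalLambda_eq_zero_of_eventually_const κ (c := classNumberPExp κ n) (n₀ := n)
    fun _ hm => classNumberPExp_eq_of_le_two_of_two_nonNorm_units_of_sup_eq_top κ n hram hn hs hxE hyE hxN hyN hxyN
      hgen hm

end Layer

end Literature.NumberTheory.IwasawaTheory

end
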